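import Mathlib
import Summits.ValiantsHypothesis.ValiantsHypothesis.Theses.GrenetZeon
import Summits.ValiantsHypothesis.ValiantsHypothesis.Theorems.GrenetZeonHessianRankCodimTwoBorderGoodPlanes
import HarnessLib

/-!
# Crux `GrenetZeon.HessianRankCodimTwo` (stmt-ValiantsHypothesis-8061): PROVED

The crux of route `GrenetZeon` (item stmt-ValiantsHypothesis-8061): there is `n₀` such that for every
`n ≥ n₀` every non-empty hypersurface section `Z(per_n) ∩ Z(g)` of the permanental hypersurface contains a
point where the `n² × n²` Hessian of `per_n` has rank `> n²/2` (the half-rank locus of the Hessian has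
codimension `≥ 2` in `Z(per_n)`).

Line `good_plane` (`Cruxes/HessianRankCodimTwo/Lines/good_plane.lean`), both stubs now proved:

* Stub 1 `stub_planeCriterion` — a GOOD PLANE (three independent matrices on whose span `Z(per_n)` misses
  the half-rank locus) forces the conclusion at `n` (projective dimension theorem in affine-cone form):
  `Theorems/GrenetZeonHessianRankCodimTwoPlaneCriterion.lean`, `planeCriterion` (val-width-8061-p1 g0).
* Stub 2 `stub_goodPlanes` — good planes exist for ALL large `n` (`goodPlanes_all_large`, file `…BorderGoodPlanes`).  For
  `n = 3p + r` with `p` prime in `(n/3.15, n/3]` (prime number theorem, proved in the tree with the standard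
  axioms; `…BorderPrimeWindow.lean`, val-width-8061-p3 g2) the BORDERED LATIN PLANE (`…BorderDefs.lean`: core
  blocks `circ(a₀,a₁,a₂) ⊗ J_p`, one pencil border block of size `r`) is good: modulo `p` its permanent is
  `(p!)³ r! · F^p w^r` and its nine core `(n-2)`-subpermanents are `(p-2)! p!² r! · P_d^p a_d^{p-2-r}
  (a_d w - u_I v_J)^{r-1}(a_d w - (r+1) u_I v_J)` (`…BorderFrobenius*`, `…BorderLowSum`, `…BorderTable*`,
  val-width-8061-p1 g2), a characteristic-`p` count shows that at most four of the nine die at any point of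
  the curve (`…BorderDeaths*`, val-width-8061-p3 g2, from 276 Bézout certificates `…BorderCert*`,
  val-width-8061-p1 g2), the count transfers to `ℂ` (`…CharPTransfer`, `…BorderAssembly`, val-width-8062-p4 g0)
  and the block-eigenvector engine (`…BlockEigen`, val-width-8061-p2 g0) gives `rank ≥ 5(p-1)² > n²/2`;
  `r = 0` is Theorem P (`…LatinGoodPlaneThreePrime`, val-width-8061-p2/p3/p4 g0).

Main result: **`hessianRankCodimTwo_proof : Theses.GrenetZeon.HessianRankCodimTwo`** — the crux BY NAME, from
`hessianRankCodimTwo_all_large` / `goodPlanes_all_large` (= `stub_goodPlanes` unfolded) of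
`…BorderGoodPlanes.lean` (val-width-8062-p4 g0, the closing instantiation of `BorderInterfaces.md` §3).
Standard axioms only.

VP ≠ VNP is NOT moved: the crux feeds only the constant-factor two-parameter bound `TwoDimCoefficients`
(stmt-ValiantsHypothesis-8062) of the route.
-/

noncomputable section

open MvPolynomial Finset
open Literature.Computability.AlgebraicComplexity

-- single-conjunct layout `Summits/ValiantsHypothesis/ValiantsHypothesis`: duplicated namespace by design
set_option linter.dupNamespace false

namespace Summit.ValiantsHypothesis.ValiantsHypothesis.Theorems.GrenetZeonHessianRankCodimTwo

/-- **The crux `HessianRankCodimTwo` of route `GrenetZeon` (stmt-ValiantsHypothesis-8061), proved:** for all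
large `n`, every non-empty hypersurface section of `Z(per_n)` contains a point where the Hessian of `per_n` has
rank `> n²/2` — good planes for all large `n` (`goodPlanes_all_large`) and the plane criterion
(`GrenetZeon.HessianRankCodimTwo.planeCriterion`), packaged as `hessianRankCodimTwo_all_large`. [folklore] -/
theorem hessianRankCodimTwo_proof : Summit.ValiantsHypothesis.ValiantsHypothesis.Theses.GrenetZeon.HessianRankCodimTwo := by
  exact hessianRankCodimTwo_all_large

end Summit.ValiantsHypothesis.ValiantsHypothesis.Theorems.GrenetZeonHessianRankCodimTwo
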